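import Mathlib
/-!
# B16Suppression — the «suppresses all powers of log g_k^{-2}» clause, kernel form

Reproduction (statement-level arithmetic only) of the suppression clause used by
T. Bałaban, *Large field renormalization. II. Localization, exponentiation, and bounds for
the R operation*, Comm. Math. Phys. 122 (1989) 355–392, p. 360 ll. 14–19:
«From this exponential decay, and the localization of ζ₀, we get an additional exponential
factor exp(−(1/2)δMR_k). It suppresses all powers of log g_k^{-2}, and all powers of M.»
with R_k ≥ (log g_k^{-2})^r, r ≥ 1 (Bałaban, CMP 119 (1988) p. 246).

What is proved: for every rate c > 0 and every power p there is a threshold x₀ such that for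
x = g^{-2} ≥ x₀ and every R ≥ (log x)^r (r ≥ 1), (log x)^p · exp(−c R) ≤ 1.  The quantifier
order (x₀ after c and p, i.e. g after (δ, M, p)) is the one recorded in GAPS C-adv7-28 (c).
Nothing here is lattice gauge theory; the paper under audit is not cited for a disputed step.
-/

namespace Literature.MathematicalPhysics.QuantumFieldTheory.Balaban1983to89.B16Suppression

open Real Filter Asymptotics

/-- Powers of `log x` are eventually dominated by `x ^ c` for every `c > 0` (Mathlib). [folklore] -/
theorem eventually_log_rpow_le (c p : ℝ) (hc : 0 < c) :
    ∀ᶠ x in atTop, (log x) ^ p ≤ x ^ c := by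
  have h := (isLittleO_log_rpow_rpow_atTop p hc).bound one_pos
  filter_upwards [h, eventually_ge_atTop (1 : ℝ)] with x hx hx1
  have hlog : 0 ≤ log x := log_nonneg hx1
  have hxc : 0 ≤ x ^ c := rpow_nonneg (by linarith) c
  rw [Real.norm_of_nonneg (rpow_nonneg hlog p), Real.norm_of_nonneg hxc, one_mul] at hx
  exact hx

/-- The suppression clause with `R ≥ log x` (the case r = 1). [cite: Balaban1989LargeFieldII, p.360 ll.14-19] -/
theorem suppression_of_le_log (c p : ℝ) (hc : 0 < c) :
    ∃ x₀ : ℝ, ∀ x ≥ x₀, ∀ R, log x ≤ R → (log x) ^ p * exp (-(c * R)) ≤ 1 := by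
  obtain ⟨x₀, hx₀⟩ := (eventually_atTop.1
    ((eventually_log_rpow_le c p hc).and (eventually_ge_atTop (1 : ℝ))))
  refine ⟨x₀, fun x hx R hR => ?_⟩
  obtain ⟨h1, hx1⟩ := hx₀ x hx
  have hxpos : 0 < x := by linarith
  have hexp : exp (-(c * R)) ≤ exp (-(c * log x)) := by
    apply exp_le_exp.2
    nlinarith
  have hrp : exp (-(c * log x)) = x ^ (-c) := by
    rw [rpow_def_of_pos hxpos]; ring_nf
  calc (log x) ^ p * exp (-(c * R)) ≤ x ^ c * x ^ (-c) := by
        rw [← hrp]; exact mul_le_mul h1 hexp (exp_pos _).le (rpow_nonneg hxpos.le c)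
    _ = 1 := by rw [← rpow_add hxpos]; simp

/-- The printed form: `R_k ≥ (log g_k^{-2})^r` with `r ≥ 1`; `x = g_k^{-2}`. [cite: Balaban1989LargeFieldII, p.360 ll.14-19; Balaban1988Convergent, p.246] -/
theorem suppression (c p r : ℝ) (hc : 0 < c) (hr : 1 ≤ r) :
    ∃ x₀ : ℝ, ∀ x ≥ x₀, ∀ R, (log x) ^ r ≤ R → (log x) ^ p * exp (-(c * R)) ≤ 1 := by
  obtain ⟨x₀, hx₀⟩ := suppression_of_le_log c p hc
  refine ⟨max x₀ (exp 1), fun x hx R hR => ?_⟩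
  have hx0 : x₀ ≤ x := le_trans (le_max_left _ _) hx
  have hxe : exp 1 ≤ x := le_trans (le_max_right _ _) hx
  have hlog1 : 1 ≤ log x := by
    have := log_le_log (exp_pos 1) hxe
    simpa using this
  have hself : log x ≤ (log x) ^ r := by
    calc log x = (log x) ^ (1 : ℝ) := (rpow_one _).symm
      _ ≤ (log x) ^ r := rpow_le_rpow_of_exponent_le hlog1 hr
  exact hx₀ x hx0 R (le_trans hself hR)

end Literature.MathematicalPhysics.QuantumFieldTheory.Balaban1983to89.B16Suppression
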